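import Mathlib
import HarnessLib
import Literature.NumberTheory.LFunctions.ZetaSumEq312
import Literature.NumberTheory.LFunctions.BourgainBilinearReduction

/-!
# Bourgain's Theorem 4 for `F = log`: the frontier after the proof of (3.12)–(3.13)

Topic `Literature/NumberTheory/LFunctions`. Two composition theorems recording exactly what the
discharge of the named fact `Literature.NumberTheory.LFunctions.Bourgain2017_theorem4_log`
(J. Bourgain, *Decoupling, exponential sums and the Riemann zeta function*, J. Amer. Math. Soc. 30
(2017), Theorem 4, eq. (3.19): `|S| ≪ M^{1/2} T^{13/84+ε}` for `17/42 ≤ log M / log T ≤ 1/2`,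
`S = ∑_{M/2 ≤ m ≤ M} e(T log(m/M))`) rests on, now that the Huxley–Watt part of §4 of the paper is
proved for `F = log`:

* `Literature.NumberTheory.LFunctions.ZetaSum.eq312_log_of_corollary3` (file `ZetaSumEq312`):
  Bourgain's (3.12), `|S|⁶ ≪_ε M^{6+ε} N⁻³ (N/R)` at `N = M T^{-2/7}`, from Corollary 3 (2.28) alone
  (the reduction (3.4)–(3.7), the double large sieve (3.8), the first spacing bound (3.10) and the
  second spacing bound (3.11) all being theorems of this tree);
* `Literature.NumberTheory.LFunctions.Bourgain2017_eq313_log_of_eq312` (file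
  `BourgainTheorem4Optimisation`): (3.12) ⟹ (3.13), i.e. Theorem 4 on `T^{3/7} ≤ M ≤ T^{1/2}`;
* `Literature.NumberTheory.LFunctions.Bourgain2017_theorem4_log_of_eq313_of_eq318` (file
  `BourgainTheorem4`): (3.13) and the cases `T^{5/12} ≤ M ≤ T^{49/114}`, `2T^{1/3} ≤ M < T^{5/12}`
  of (3.18) ⟹ Theorem 4 (the last display before Theorem 4 in the paper);
* `Literature.NumberTheory.LFunctions.Bourgain2017_corollary3_of_eq210` (file
  `BourgainBilinearReduction`): Corollary 3 (2.28) ⟸ Theorem 2 (2.12) ⟸ (2.23) ⟸ (2.22) ⟸ (2.10),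
  i.e. all of §3 of the paper.

Hence (`Bourgain2017_theorem4_log_of_corollary3_of_eq318`,
`Bourgain2017_theorem4_log_of_eq210_of_eq318`) Theorem 4 for `F = log` follows from exactly two
inputs, both taken here as hypotheses written out in full:

1. `h210` — Bourgain's decoupling bound (2.10) for the curves `(t, t², φ₃(t), φ₄(t))` satisfying
   (2.11) (the content of Theorem 1 of the paper for `d = 4` together with the Bourgain–Demeter `L⁶`
   decoupling (1.5) for the parabola, eqs. (1.2)–(2.10); `ℓ²`-decoupling is not available in this
   tree), or directly its consequence `hC3` = Corollary 3 (2.28);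
2. `h318` — the two lower cases of Bourgain's (3.18) for `F = log`,
   `|S|⁶ ≪_ε M^{4+ε} T^{1/2}` on `[T^{5/12}, T^{49/114}]` and `|S|⁶ ≪_ε M^{2+ε} T^{4/3}` on
   `[2T^{1/3}, T^{5/12})`, which the paper obtains from (3.14)–(3.17) using Huxley's treatment of the
   second spacing problem by resonance curves ((3.15) = Huxley, *Proc. London Math. Soc.* (3) 66
   (1993) §7; monograph *Area, Lattice Points and Exponential Sums* (1996), Part IV). Only the range
   `T^{17/42} ≤ M < T^{3/7}` of `h318` is used. With the Huxley–Watt second spacing lemma proved in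
   this tree (`SecondSpacingLemma`, Graham–Kolesnik Lemma 7.18) the term `Δ₂A²` of that lemma
   forces `M ≥ T^{3/7}` (see the docstring of `ZetaSumEq312`), so this range is precisely where
   Huxley's refinement is needed.

No new definitions and no new named facts are introduced.

## References

* J. Bourgain, *Decoupling, exponential sums and the Riemann zeta function*, J. Amer. Math. Soc. 30
  (2017), 205–224, doi:10.1090/jams/860 — Theorem 4 (3.19); (2.10), (2.11), Corollary 3 (2.28);
  §4 (3.12), (3.13), (3.18). [BourgainJAMS2017]
* M. N. Huxley, *Exponential sums and the Riemann zeta function IV*, Proc. London Math. Soc. (3) 66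
  (1993), 1–40 — §7 (the source of (3.15)). [Huxley1993]
* M. N. Huxley, *Resonance curves in the Bombieri–Iwaniec method*, Funct. Approx. Comment. Math.
  32 (2004), 7–49, doi:10.7169/facm/1538186623 — the self-contained (open-access) account of the
  second spacing problem and the resonance curves behind (3.15); the counting of resonances is in
  its companion, Proc. London Math. Soc. (3) 90 (2005), 1–41. [Huxley2004]
-/

noncomputable section

open Complex MeasureTheory Finset
open scoped Real

namespace Literature.NumberTheory.LFunctions

/-- **Bourgain 2017, Theorem 4 for `F = log` from Corollary 3 (2.28) and the lower cases of (3.18).**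
`Literature.NumberTheory.LFunctions.Bourgain2017_theorem4_log` follows from Corollary 3 (`hC3`, the
mean value bound `A₆(N; δ, Δ) ≪_ε δ Δ N^{9+ε}` for `N⁻² ≤ δ ≤ 1`, `N⁻¹ ≤ Δ ≤ 1`, in the vocabulary
of `Literature.NumberTheory.LFunctions.bourgainA6`) and the cases `T^{5/12} ≤ M ≤ T^{49/114}` and
`2T^{1/3} ≤ M < T^{5/12}` of (3.18) for `F = log` (`h318`): the range `T^{3/7} ≤ M ≤ √T` is
`Literature.NumberTheory.LFunctions.ZetaSum.eq312_log_of_corollary3` (Bourgain (3.4)–(3.12), proved)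
followed by `Literature.NumberTheory.LFunctions.Bourgain2017_eq313_log_of_eq312` ((3.13), with
`c = 1`), and the three ranges are glued by
`Literature.NumberTheory.LFunctions.Bourgain2017_theorem4_log_of_eq313_of_eq318`.
[cite: BourgainJAMS2017, Theorem 4, eq. (3.19); Corollary 3 (2.28); §4 (3.12)–(3.13), (3.18)] -/
theorem Bourgain2017_theorem4_log_of_corollary3_of_eq318
    (hC3 : ∀ ε : ℝ, 0 < ε → ∃ C : ℝ, ∀ N : ℕ, 1 ≤ N → ∀ δ Δ : ℝ,
      1 / (N : ℝ) ^ 2 ≤ δ → δ ≤ 1 → 1 / (N : ℝ) ≤ Δ → Δ ≤ 1 →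
        bourgainA6 N δ Δ ≤ C * δ * Δ * (N : ℝ) ^ (9 + ε))
    (h318 : ∀ ε : ℝ, 0 < ε → ∃ C T₀ : ℝ, ∀ T : ℝ, T₀ ≤ T → ∀ M : ℝ,
      (T ^ (5 / 12 : ℝ) ≤ M → M ≤ T ^ (49 / 114 : ℝ) →
          ‖bourgainSum Real.log T M‖ ^ 6 ≤ C * M ^ (4 + ε) * T ^ (1 / 2 : ℝ)) ∧
      (2 * T ^ (1 / 3 : ℝ) ≤ M → M < T ^ (5 / 12 : ℝ) →
          ‖bourgainSum Real.log T M‖ ^ 6 ≤ C * M ^ (2 + ε) * T ^ (4 / 3 : ℝ))) :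
    Bourgain2017_theorem4_log := by
  refine Bourgain2017_theorem4_log_of_eq313_of_eq318 ?_ h318
  intro ε hε
  obtain ⟨C, T₀, H⟩ :=
    Bourgain2017_eq313_log_of_eq312 one_pos le_rfl (ZetaSum.eq312_log_of_corollary3 hC3) ε hε
  exact ⟨C, T₀, fun T hT M hMl hMu => H T hT M (by rwa [one_mul]) hMu⟩

/-- **Bourgain 2017, Theorem 4 for `F = log` from the decoupling bound (2.10) and the lower cases of
(3.18).** As `Literature.NumberTheory.LFunctions.Bourgain2017_theorem4_log_of_corollary3_of_eq318`,
with Corollary 3 supplied by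
`Literature.NumberTheory.LFunctions.Bourgain2017_corollary3_of_eq210` from Bourgain's decoupling
bound (2.10) for the curves `(t, t², φ₃, φ₄)` satisfying (2.11) (`h210`, written out exactly as
there). After this theorem the discharge of
`Literature.NumberTheory.LFunctions.Bourgain2017_theorem4_log` rests on (2.10) (ℓ²-decoupling,
Theorem 1 of the paper with `d = 4` over the Bourgain–Demeter `L⁶` decoupling for the parabola) and on
the two lower cases of (3.18) (Huxley's resonance-curve bound (3.15) for the second spacing
problem), and on nothing else. [cite: BourgainJAMS2017, Theorem 4, eq. (3.19); eqs. (2.10)–(2.11);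
§4 (3.18)] -/
theorem Bourgain2017_theorem4_log_of_eq210_of_eq318
    (h210 : ∀ ε c B : ℝ, 0 < ε → 0 < c → ∃ C : ℝ,
      ∀ (φ₃ φ₃₁ φ₃₂ φ₃₃ φ₃₄ φ₃₅ φ₄ φ₄₁ φ₄₂ φ₄₃ φ₄₄ φ₄₅ : ℝ → ℝ),
        (∀ t ∈ Set.Icc (0 : ℝ) 1,
          HasDerivAt φ₃ (φ₃₁ t) t ∧ HasDerivAt φ₃₁ (φ₃₂ t) t ∧ HasDerivAt φ₃₂ (φ₃₃ t) t ∧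
            HasDerivAt φ₃₃ (φ₃₄ t) t ∧ HasDerivAt φ₃₄ (φ₃₅ t) t ∧
          HasDerivAt φ₄ (φ₄₁ t) t ∧ HasDerivAt φ₄₁ (φ₄₂ t) t ∧ HasDerivAt φ₄₂ (φ₄₃ t) t ∧
            HasDerivAt φ₄₃ (φ₄₄ t) t ∧ HasDerivAt φ₄₄ (φ₄₅ t) t) →
        (∀ t ∈ Set.Icc (0 : ℝ) 1,
          |φ₃ t| ≤ B ∧ |φ₃₁ t| ≤ B ∧ |φ₃₂ t| ≤ B ∧ |φ₃₃ t| ≤ B ∧ |φ₃₄ t| ≤ B ∧ |φ₃₅ t| ≤ B ∧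
          |φ₄ t| ≤ B ∧ |φ₄₁ t| ≤ B ∧ |φ₄₂ t| ≤ B ∧ |φ₄₃ t| ≤ B ∧ |φ₄₄ t| ≤ B ∧ |φ₄₅ t| ≤ B) →
        (∀ t ∈ Set.Icc (0 : ℝ) 1, c ≤ |φ₃₃ t|) →
        (∀ s ∈ Set.Icc (0 : ℝ) 1, ∀ t ∈ Set.Icc (0 : ℝ) 1,
          c ≤ |φ₃₃ s * φ₄₄ t - φ₄₃ s * φ₃₄ t|) →
        ∀ M : ℕ, 1 ≤ M → ∀ a b a' b' : ℕ, a ≤ b → b < a' → a' ≤ b' → b' ≤ M →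
          (M : ℝ) ≤ 4 * ((a' : ℝ) - b) → ∀ c₀ c₀' : ℝ,
          (∫ y in Set.Icc ![0, 0, c₀, c₀'] ![1, 1, c₀ + (M : ℝ) ^ 2, c₀' + M],
            ‖∑ m ∈ Finset.Icc a b, Complex.exp (2 * ↑π * I *
                ↑((m : ℝ) * y 0 + (m : ℝ) ^ 2 * y 1 + φ₃ ((m : ℝ) / M) * y 2 + φ₄ ((m : ℝ) / M) * y 3))‖ ^ 6 *
              ‖∑ m ∈ Finset.Icc a' b', Complex.exp (2 * ↑π * I *
                ↑((m : ℝ) * y 0 + (m : ℝ) ^ 2 * y 1 + φ₃ ((m : ℝ) / M) * y 2 + φ₄ ((m : ℝ) / M) * y 3))‖ ^ 6) ≤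
            C * (M : ℝ) ^ (9 + ε))
    (h318 : ∀ ε : ℝ, 0 < ε → ∃ C T₀ : ℝ, ∀ T : ℝ, T₀ ≤ T → ∀ M : ℝ,
      (T ^ (5 / 12 : ℝ) ≤ M → M ≤ T ^ (49 / 114 : ℝ) →
          ‖bourgainSum Real.log T M‖ ^ 6 ≤ C * M ^ (4 + ε) * T ^ (1 / 2 : ℝ)) ∧
      (2 * T ^ (1 / 3 : ℝ) ≤ M → M < T ^ (5 / 12 : ℝ) →
          ‖bourgainSum Real.log T M‖ ^ 6 ≤ C * M ^ (2 + ε) * T ^ (4 / 3 : ℝ))) :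
    Bourgain2017_theorem4_log :=
  Bourgain2017_theorem4_log_of_corollary3_of_eq318 (Bourgain2017_corollary3_of_eq210 h210) h318

end Literature.NumberTheory.LFunctions
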